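import Summits.ResolutionOfSingularities.ResolutionOfSingularities.Theorems.ValuativeLuAlphaPTorsorQuadraticDerivation

/-!
# The derivation chain with scaling along a discrete quadratic sequence

Helper file for the line `pfaff-line-log-final-forms` of the crux `Valuative.LuAlphaPTorsor`
(item `stmt-ResolutionOfSingularities-0641`), discrete rank-one case, E1 layer L2c
(registered helper stub `discreteSequence_derivationChain`).

Setting: `K` a field, `O ⊆ K` a valuation ring, `R 0 → R 1 → ⋯` the quadratic sequence of a
two-dimensional regular local ring `R 0` of `K` along `O` (tree `QuadraticTransforms*.lean`), in
the free `π`-chart regime from stage `i₀` on: `π ∈ R i` is a non-unit (`v(π) < 1`), every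
non-unit `z` of `R i` has `z/π ∈ R (i+1)`, and `𝔪_{R i} ⊆ (π, y i)` element-wise for a non-unit
`y i` of `R i`. Let `D₀` be a `ℤ`-derivation of the FIELD `K` with `D₀ π = 0` which maps `R i₀`
into itself. PROVED (`discreteSequence_derivationChain`): there is `h : ℕ → K` with `h i₀ = 1`
such that for every `i ≥ i₀` the derivation `Dᵢ := h i • D₀` maps `R i` into `R i`,
`0 ≠ h i ∈ R i`, and `h (i+1) = π * h i` if `Dᵢ` is transversal at stage `i` (`Dᵢ (y i)` is a
unit of `R i`) while `h (i+1) = h i` otherwise.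

The one-step extension (`mul_derivation_mem_of_step`): if `c • D₀` maps `R i` into `R i` and
`c D₀ (y i) ∈ 𝔪_{R i}`, then `c • D₀` is logarithmic at the closed point
(`c D₀ (a π + b y) = (c D₀ a) π + (c D₀ b) y + b (c D₀ y) ∈ 𝔪`, as `D₀ π = 0`), so its
restriction to `R i` extends to a `ℤ`-derivation `δ₁` of `R (i+1)`
(`exists_derivation_quadraticTransformAlong`); and `δ₁ = c • D₀` on `R (i+1)` by the quotient
rule, every element of `R (i+1)` being a quotient of elements of `R 0 ⊆ R i`. In the transversal
case one applies this to `π c • D₀` (`π c D₀ (y i) ∈ π R i ⊆ 𝔪`). All [folklore]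
(Seidenberg 1966; Giraud, Cossart: derivations along quadratic sequences).
-/

set_option linter.dupNamespace false

namespace Summit.ResolutionOfSingularities.ResolutionOfSingularities.Theorems.PfaffLine

open IsLocalRing Literature.AlgebraicGeometry.Resolution

section Step

variable {K : Type} [Field K]

/-- Restriction: if `c • D₀` maps the subring `S` of the field `K` into itself, it restricts to a
`ℤ`-derivation `δ` of `S` with `δ x = c D₀ x`. [folklore] -/
private theorem exists_derivation_restrict (S : Subring K) (D₀ : Derivation ℤ K K) (c : K)
    (hc : ∀ z ∈ S, c * D₀ z ∈ S) :
    ∃ δ : Derivation ℤ S S, ∀ x : S, ((δ x : S) : K) = c * D₀ x := by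
  let D₁ : S →+ S := AddMonoidHom.mk' (fun x => ⟨c * D₀ x, hc x x.2⟩) fun a b =>
    Subtype.ext (by
      change c * D₀ ((a : K) + b) = c * D₀ a + c * D₀ b
      rw [map_add, mul_add])
  refine ⟨Derivation.mk' D₁.toIntLinearMap fun a b => Subtype.ext ?_, fun x => rfl⟩
  change c * D₀ ((a : K) * b) = (a : K) * (c * D₀ b) + (b : K) * (c * D₀ a)
  rw [Derivation.leibniz, smul_eq_mul, smul_eq_mul]
  ring

/-- Uniqueness of extensions by the quotient rule: if `δ₁ ∈ Der_ℤ(S₁)` agrees with `c • D₀` on a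
subset `R₀ ⊆ S₁` of which every element of `K` is a quotient, then `δ₁ z = c D₀ z` for all
`z ∈ S₁`; in particular `c D₀ z ∈ S₁`. [folklore] -/
private theorem mul_derivation_mem_of_agree {S₁ R₀ : Subring K} (hR₀ : R₀ ≤ S₁)
    (hfrac : ∀ z : K, ∃ a ∈ R₀, ∃ b ∈ R₀, b ≠ 0 ∧ z = a / b) {D₀ : Derivation ℤ K K} {c : K}
    (δ₁ : Derivation ℤ S₁ S₁) (hagree : ∀ (a : K) (ha : a ∈ R₀), ((δ₁ ⟨a, hR₀ ha⟩ : S₁) : K) = c * D₀ a)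
    (z : K) (hz : z ∈ S₁) : c * D₀ z ∈ S₁ := by
  obtain ⟨a, ha, b, hb, hb0, hzab⟩ := hfrac z
  have hmul : (⟨a, hR₀ ha⟩ : S₁) = ⟨z, hz⟩ * ⟨b, hR₀ hb⟩ :=
    Subtype.ext (by
      change a = z * b
      rw [hzab, div_mul_cancel₀ a hb0])
  -- Leibniz for `δ₁` on `a = z b`, read in `K`
  have e₁ : c * D₀ a = z * (c * D₀ b) + b * ((δ₁ ⟨z, hz⟩ : S₁) : K) := by
    rw [← hagree a ha, ← hagree b hb, hmul, Derivation.leibniz, smul_eq_mul, smul_eq_mul]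
    rfl
  -- Leibniz for `D₀` on `a = z b`
  have e₂ : D₀ a = z * D₀ b + b * D₀ z := by
    have : a = z * b := by rw [hzab, div_mul_cancel₀ a hb0]
    rw [this, Derivation.leibniz, smul_eq_mul, smul_eq_mul]
  have e₃ : ((δ₁ ⟨z, hz⟩ : S₁) : K) = c * D₀ z := by
    apply mul_left_cancel₀ hb0
    have := e₁
    rw [e₂] at this
    linear_combination -this
  rw [← e₃]
  exact (δ₁ ⟨z, hz⟩).2

/-- **One step of the chain.** Let `S₁` be the quadratic transform of `S` along `O`, every
element of `K` a quotient of elements of `R₀ ⊆ S`, `π, y` non-units of `S` with `𝔪_S ⊆ (π, y)`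
element-wise, and `D₀ ∈ Der_ℤ(K)` with `D₀ π = 0`. If `c • D₀` maps `S` into `S` and `c D₀ y` is a
non-unit of `S`, then `c • D₀` maps `S₁` into `S₁`: `c • D₀` is logarithmic at the closed point of
`S` (`c D₀ (a π + b y) = (c D₀ a) π + (c D₀ b) y + b (c D₀ y)`), hence extends to `S₁`
(`exists_derivation_quadraticTransformAlong`), and the extension is `c • D₀` by the quotient rule.
[folklore] -/
private theorem mul_derivation_mem_of_step {O : ValuationSubring K} {S S₁ R₀ : Subring K}
    (h : IsQuadraticTransformAlong O S S₁)
    (hfrac : ∀ z : K, ∃ a ∈ R₀, ∃ b ∈ R₀, b ≠ 0 ∧ z = a / b) (hR₀S : R₀ ≤ S)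
    {D₀ : Derivation ℤ K K} {π y c : K} (hπ : D₀ π = 0) (hπS : π ∈ S) (hπinv : π⁻¹ ∉ S)
    (hyS : y ∈ S) (hyinv : y⁻¹ ∉ S)
    (hspan : ∀ z : K, z ∈ S → z⁻¹ ∉ S → ∃ a ∈ S, ∃ b ∈ S, z = a * π + b * y)
    (hc : ∀ z ∈ S, c * D₀ z ∈ S) (hcy : c * D₀ y = 0 ∨ (c * D₀ y)⁻¹ ∉ S) :
    ∀ z ∈ S₁, c * D₀ z ∈ S₁ := by
  obtain ⟨hloc, -⟩ := h.fg_maximalIdeal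
  obtain ⟨δ, hδ⟩ := exists_derivation_restrict S D₀ c hc
  -- `c • D₀` is logarithmic at the closed point of `S`
  have hlog : ∀ x ∈ maximalIdeal S, δ x ∈ maximalIdeal S := by
    intro x hx
    rcases (mem_maximalIdeal_iff_inv_not_mem x).mp hx with hx0 | hxinv
    · have hx0' : x = 0 := Subtype.ext hx0
      rw [hx0', map_zero]
      exact zero_mem _
    · obtain ⟨a, ha, b, hb, hxab⟩ := hspan x x.2 hxinv
      have hπm : (⟨π, hπS⟩ : S) ∈ maximalIdeal S :=
        (mem_maximalIdeal_iff_inv_not_mem _).mpr (Or.inr hπinv)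
      have hym : (⟨y, hyS⟩ : S) ∈ maximalIdeal S :=
        (mem_maximalIdeal_iff_inv_not_mem _).mpr (Or.inr hyinv)
      have hcym : (⟨c * D₀ y, hc y hyS⟩ : S) ∈ maximalIdeal S :=
        (mem_maximalIdeal_iff_inv_not_mem _).mpr hcy
      have e : δ x = ⟨c * D₀ a, hc a ha⟩ * ⟨π, hπS⟩ + ⟨c * D₀ b, hc b hb⟩ * ⟨y, hyS⟩ +
          ⟨b, hb⟩ * ⟨c * D₀ y, hc y hyS⟩ := by
        apply Subtype.ext
        rw [hδ x]
        change c * D₀ (x : K) = c * D₀ a * π + c * D₀ b * y + b * (c * D₀ y)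
        rw [hxab, map_add, Derivation.leibniz, Derivation.leibniz, hπ]
        simp only [smul_eq_mul]
        ring
      rw [e]
      exact add_mem (add_mem (Ideal.mul_mem_left _ _ hπm) (Ideal.mul_mem_left _ _ hym))
        (Ideal.mul_mem_left _ _ hcym)
  -- extend to `S₁` and compare with `c • D₀` by the quotient rule
  obtain ⟨δ₁, hδ₁⟩ := exists_derivation_quadraticTransformAlong O S S₁ h δ hlog
  refine mul_derivation_mem_of_agree (hR₀S.trans h.le) hfrac δ₁ fun a ha => ?_
  rw [← hδ ⟨a, hR₀S ha⟩]
  exact congrArg (fun w : S₁ => (w : K)) (hδ₁ ⟨a, hR₀S ha⟩)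

/-- A non-zero element of value `< 1` has its inverse outside every subring of `O`. [folklore] -/
private theorem inv_not_mem_of_lt_one {O : ValuationSubring K} {S : Subring K}
    (hS : S ≤ O.toSubring) {π : K} (hπ0 : π ≠ 0) (hπ1 : O.valuation π < 1) : π⁻¹ ∉ S := by
  intro hmem
  have h1 : O.valuation π⁻¹ ≤ 1 := (O.valuation_le_one_iff _).mpr (hS hmem)
  rw [map_inv₀, inv_le_one₀ (pos_iff_ne_zero.mpr ((map_ne_zero _).mpr hπ0))] at h1
  exact not_lt.mpr h1 hπ1

end Step

/-- **Registered stub `discreteSequence_derivationChain`** (E1 layer L2c): the derivation chain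
with scaling. In the free `π`-chart regime from stage `i₀` of the quadratic sequence `R` along
`O'` (`π` of value `< 1`), a derivation `D₀ ∈ Der_ℤ(K')` with `D₀ π = 0` mapping `R i₀` into
itself gives `h : ℕ → K'`, `h i₀ = 1`, with `0 ≠ h i ∈ R i`, `h i • D₀ (R i) ⊆ R i`, and
`h (i+1) = π h i` if `h i • D₀` is transversal at stage `i` (`h i D₀ (y i)` a unit of `R i`),
`h (i+1) = h i` otherwise. Construction by recursion; the step is `mul_derivation_mem_of_step`
applied to `h i • D₀` (logarithmic case) or to `π h i • D₀` (transversal case,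
`π h i D₀ (y i) ∈ π R i ⊆ 𝔪`). [folklore] -/
theorem discreteSequence_derivationChain :
    ∀ (K' : Type) [Field K'] (O' : ValuationSubring K') (R : ℕ → Subring K') (π : K') (i₀ : ℕ) (y : ℕ → K') (D₀ : Derivation ℤ K' K'), IsRegularLocalRing (R 0) → ringKrullDim (R 0) = 2 → Literature.AlgebraicGeometry.Resolution.IsLocalRingOf (R 0) → Literature.AlgebraicGeometry.Resolution.SubringDominates (R 0) O'.toSubring → (∀ i, Literature.AlgebraicGeometry.Resolution.IsQuadraticTransformAlong O' (R i) (R (i + 1))) → π ≠ 0 → O'.valuation π < 1 → (∀ i : ℕ, i₀ ≤ i → π ∈ R i ∧ (∀ z : K', z ∈ R i → z⁻¹ ∉ R i → z / π ∈ R (i + 1)) ∧ (y i ∈ R i ∧ (y i)⁻¹ ∉ R i ∧ ∀ z : K', z ∈ R i → z⁻¹ ∉ R i → ∃ a ∈ R i, ∃ b ∈ R i, z = a * π + b * y i)) → D₀ π = 0 → (∀ z : K', z ∈ R i₀ → D₀ z ∈ R i₀) → ∃ h : ℕ → K', h i₀ = 1 ∧ ∀ i : ℕ, i₀ ≤ i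 → h i ≠ 0 ∧ h i ∈ R i ∧ (∀ z : K', z ∈ R i → h i * D₀ z ∈ R i) ∧ ((h i * D₀ (y i) ≠ 0 ∧ (h i * D₀ (y i))⁻¹ ∈ R i) → h (i + 1) = π * h i) ∧ (¬ (h i * D₀ (y i) ≠ 0 ∧ (h i * D₀ (y i))⁻¹ ∈ R i) → h (i + 1) = h i) := by
  intro K _ O R π i₀ y D₀ _ _ hof _ hstep hπ0 hπ1 hfree hD₀π hD₀
  classical
  -- the recursion defining `h (i₀ + n) = g n`
  obtain ⟨g, hg0, hgs⟩ : ∃ g : ℕ → K, g 0 = 1 ∧ ∀ n, g (n + 1) =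
      if g n * D₀ (y (i₀ + n)) ≠ 0 ∧ (g n * D₀ (y (i₀ + n)))⁻¹ ∈ R (i₀ + n) then π * g n
      else g n :=
    ⟨fun n => Nat.rec (motive := fun _ => K) 1
      (fun n c => if c * D₀ (y (i₀ + n)) ≠ 0 ∧ (c * D₀ (y (i₀ + n)))⁻¹ ∈ R (i₀ + n) then π * c
        else c) n, rfl, fun _ => rfl⟩
  have hmono : Monotone R := sequence_monotone hstep
  have hπinv : ∀ i, π⁻¹ ∉ R i := fun i => inv_not_mem_of_lt_one (hstep i).source_le hπ0 hπ1
  -- the inductive invariant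
  have key : ∀ n : ℕ, g n ≠ 0 ∧ g n ∈ R (i₀ + n) ∧ ∀ z ∈ R (i₀ + n), g n * D₀ z ∈ R (i₀ + n) := by
    intro n
    induction n with
    | zero =>
      rw [hg0, Nat.add_zero]
      exact ⟨one_ne_zero, one_mem _, fun z hz => by rw [one_mul]; exact hD₀ z hz⟩
    | succ n ih =>
      obtain ⟨hg0', hgR, hgD⟩ := ih
      obtain ⟨hπR, -, hyR, hyinv, hspan⟩ := hfree (i₀ + n) (Nat.le_add_right _ _)
      have hst : IsQuadraticTransformAlong O (R (i₀ + n)) (R (i₀ + (n + 1))) := hstep (i₀ + n)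
      rw [hgs n]
      split_ifs with hT
      · -- transversal: scale by `π`
        refine ⟨mul_ne_zero hπ0 hg0', hst.le (mul_mem hπR hgR), ?_⟩
        refine mul_derivation_mem_of_step hst hof.2 (hmono (Nat.zero_le _)) hD₀π hπR
          (hπinv _) hyR hyinv hspan (fun z hz => ?_) (Or.inr fun hinv => hπinv (i₀ + n) ?_)
        · rw [mul_assoc]
          exact mul_mem hπR (hgD z hz)
        · have e : g n * D₀ (y (i₀ + n)) * (π * g n * D₀ (y (i₀ + n)))⁻¹ = π⁻¹ := by
            rw [mul_assoc π, mul_inv, mul_comm π⁻¹, ← mul_assoc, mul_inv_cancel₀ hT.1, one_mul]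
          rw [← e]
          exact mul_mem (hgD _ hyR) hinv
      · -- logarithmic: keep `h`
        refine ⟨hg0', hst.le hgR, ?_⟩
        refine mul_derivation_mem_of_step hst hof.2 (hmono (Nat.zero_le _)) hD₀π hπR
          (hπinv _) hyR hyinv hspan hgD ?_
        by_cases h0 : g n * D₀ (y (i₀ + n)) = 0
        · exact Or.inl h0
        · exact Or.inr fun hinv => hT ⟨h0, hinv⟩
  refine ⟨fun i => g (i - i₀), ?_, fun i hi => ?_⟩
  · show g (i₀ - i₀) = 1
    rw [Nat.sub_self, hg0]
  obtain ⟨n, rfl⟩ := Nat.exists_eq_add_of_le hi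
  have e1 : i₀ + n - i₀ = n := by omega
  have e2 : i₀ + n + 1 - i₀ = n + 1 := by omega
  simp only [e1, e2]
  obtain ⟨hg0', hgR, hgD⟩ := key n
  exact ⟨hg0', hgR, hgD, fun hT => by rw [hgs n, if_pos hT], fun hT => by rw [hgs n, if_neg hT]⟩

end Summit.ResolutionOfSingularities.ResolutionOfSingularities.Theorems.PfaffLine
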